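import Mathlib.Analysis.Complex.Basic
import Summits.ABC.IUTFork.Joshi.FrobenioidsJoshi

/-!
# Joshi, ATS III (arXiv 2401.13508v4) §10.1 (10.1.1)–(10.1.4): for an ARCHIMEDEAN valued field the value group is all
# of `ℝ_{>0}` — `Φ(ℂ)^gp = ℝ`, `Φ(ℂ) ≅ ℝ_{≥0}` — DERIVABLE row of [J-III] §10.1, discharged over seat E-t32's carriers

Proof-only companion (abc-iut cell, branch E, seat abc-iut-E-t34; §4-fallback DERIVABLE discharge on E-t32's landed
`Joshi/FrobenioidsJoshi.lean` p430621; rung LADDER-ABC:A2.E). TAKES NO SIDE on [IUTchIII] Cor. 3.12 or on any author;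
typed ≠ proved; Mathlib facts about `|−|_ℂ`, `|−|_ℝ` only. [claim: Joshi2024ATS3, status: disputed]

WHAT. §10.1 (p.129 l.1–18): for `K` archimedean ("`K ≃ ℂ` as valued fields"), "`Φ(K) = ℝ_{≥0}`" (10.1.1) and
"`Φ(K)^gp = ℝ`", with `z ↦ log(|z|_ℂ)` (10.1.3). E-t32's file types every valued field uniformly through
`Frob.normAbs`; in its value coordinates the archimedean statements read: the value group `Frob.divGroup (normAbs ℂ)`
is ALL of `ℝ_{>0}` (`Frob.HasRealValueGroup`, print's "`Φ(K)^gp = ℝ`" after `log`) and the value monoid is all of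
`(0, 1]` (print's "`Φ(K) = ℝ_{≥0}`" after `−log`) — here PROVED for `ℂ` and `ℝ` from `|(r : ℂ)| = r` (`r ≥ 0`), via
E-t32's `prop1041_2_holds`.
-/

noncomputable section

namespace Summit.ABC.IUTFork.Joshi.ATS3.Frob

/-- **(10.1.1)/(10.1.2) for `K = ℂ`: the value group of `(ℂ, |−|_ℂ)` is all of `ℝ_{>0}`** ("`Φ(K)^gp = ℝ`").
[claim: Joshi2024ATS3, status: disputed] -/
theorem hasRealValueGroup_complex : HasRealValueGroup (normAbs ℂ) := by
  intro r hr
  have hr0 : ((r : ℝ) : ℂ) ≠ 0 := by exact_mod_cast hr.ne'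
  refine ⟨Units.mk0 ((r : ℝ) : ℂ) hr0, Units.ext ?_⟩
  rw [val_absUnits, Units.val_mk0, normAbs_apply, Complex.norm_real, Real.norm_eq_abs, abs_of_pos hr]

/-- **(10.1.1) for `K = ℂ`: `Φ(ℂ)` is all of `(0, 1]`** (print: "`Φ(K) = ℝ_{≥0}`", the same monoid after `−log`),
and `Φ(ℂ)^gp` is perfect — E-t32's `prop1041_2_holds` applied to `hasRealValueGroup_complex`.
[claim: Joshi2024ATS3, status: disputed] -/
theorem divMonoid_complex_eq (r : ℝˣ) (hr0 : 0 < (r : ℝ)) (hr1 : (r : ℝ) ≤ 1) : r ∈ divMonoid (normAbs ℂ) :=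
  ((prop1041_2_holds (normAbs ℂ)) hasRealValueGroup_complex).2 r hr0 hr1

/-- `Φ(ℂ)^gp` is perfect (every value has all roots). [claim: Joshi2024ATS3, status: disputed] -/
theorem isPerfectDiv_complex : IsPerfectDiv (normAbs ℂ) :=
  ((prop1041_2_holds (normAbs ℂ)) hasRealValueGroup_complex).1

/-- The same for `K = ℝ` (an archimedean valued field NOT containing `√−1`; print assumes `√−1 ∈ K`, p.129 l.1–2 —
recorded to show the typing does not depend on it). [folklore] -/
theorem hasRealValueGroup_real : HasRealValueGroup (normAbs ℝ) := by
  intro r hr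
  refine ⟨Units.mk0 (r : ℝ) hr.ne', Units.ext ?_⟩
  rw [val_absUnits, Units.val_mk0, normAbs_apply, Real.norm_eq_abs, abs_of_pos hr]

/-- (10.1.3): the archimedean degree of `z ∈ ℂ^*` is `log |z|_ℂ`, and it is SURJECTIVE onto `ℝ` ("`K^* → Φ(K)^gp =
ℝ`"): every real number is a degree. [claim: Joshi2024ATS3, status: disputed] -/
theorem deg_complex_surjective : Function.Surjective fun z : ℂˣ => (deg (normAbs ℂ) z).toAdd := by
  intro t
  have h0 : ((Real.exp t : ℝ) : ℂ) ≠ 0 := by exact_mod_cast (Real.exp_pos t).ne'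
  refine ⟨Units.mk0 _ h0, ?_⟩
  show (deg (normAbs ℂ) (Units.mk0 _ h0)).toAdd = t
  rw [toAdd_deg, Units.val_mk0, normAbs_apply, Complex.norm_real, Real.norm_eq_abs, abs_of_pos (Real.exp_pos t),
    Real.log_exp]

end Summit.ABC.IUTFork.Joshi.ATS3.Frob

end
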